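import Summits.Parity.GeneralizedHardyLittlewood.Theorems.LeeYangFibresRelativeDimOneMoebiusSplitDefs
import Summits.Parity.GeneralizedHardyLittlewood.Theorems.LeeYangFibresRelativeDimOneMoebiusSplitStubDefs
import Summits.Parity.GeneralizedHardyLittlewood.Theorems.LeeYangFibresRelativeDimOneMoebiusSplitLatticeCount
import Summits.Parity.GeneralizedHardyLittlewood.Theorems.LeeYangFibresRelativeDimOneMoebiusSplitAssembly
import Summits.Parity.GeneralizedHardyLittlewood.Theorems.LeeYangFibresRelativeDimOneMoebiusSplitTSSInduction
import Summits.Parity.GeneralizedHardyLittlewood.Theorems.LeeYangFibresRelativeDimOneMoebiusSplitTSSLocalData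
import Summits.Parity.GeneralizedHardyLittlewood.Theorems.LeeYangFibresRelativeDimOneMoebiusSplitTSSCompose
import Summits.Parity.GeneralizedHardyLittlewood.Theorems.LeeYangFibresRelativeDimOneMoebiusSplitMoebiusTermBV
import Summits.Parity.GeneralizedHardyLittlewood.Theorems.LeeYangFibresRelativeDimOneMoebiusSplitTermExpansion
import Summits.Parity.GeneralizedHardyLittlewood.Theorems.LeeYangFibresRelativeDimOneMoebiusSplitTermClassSums
import Summits.Parity.GeneralizedHardyLittlewood.Theorems.LeeYangFibresAbsoluteUpgradeSlices
import Literature.NumberTheory.Sieve.LinearEquationsInPrimesSingularSeries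
import HarnessLib

/-!
# Route `LeeYangFibres`, crux `RelativeDimOne` (stmt-Parity-14113), line `single-moebius-split`:
# the reduction of the crux to the single-Möbius hybrid atom (everything else discharged)

This file composes the LANDED stubs of the line into sorry-free theorems:

* `relativeDimOne_of_hybrid` — **the crux follows from the atom alone**:
  `(∀ s ≥ 1, ∃ η > 0, ∀ C A, HybridOneMoebius s η C A) → RelativeDimOne` (registered sub-goal of the crux
  item). The hypothesis is the single-Möbius hybrid Hardy–Littlewood–Chowla schema (one Möbius factor along a
  progression of modulus `≤ L Y^η` against `s` dilated prime forms, log-power saving; Lichtman–Teräväinen Conj. 1.1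
  / Tao–Teräväinen Conj. 1.3 type; Sawin–Shusterman Cor. 6.1 over `𝔽_q[T]`), an OPEN problem — so the crux item is
  NOT closed by this file; what is kernel-checked is the one-directional reduction.
* `relDimOneSlice_of_hybrid_below` — the `(k+1)`-form slice of the crux needs the atom only for `s ≤ k`;
* `relDimOneSlice_one` — the one-form slice (uniform prime number theorem in progressions with the Green–Tao
  error `ε(β_∞𝔖 + N)`) UNCONDITIONALLY;
* `relDimOneSlice_two_of_hybrid_one` — the two-form slice (uniform twin-prime / Goldbach-type pairs `(ψ₀, ψ₁)`)
  from `H_1` alone: Möbius against ONE dilated shifted prime.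

Ingredients (all landed): T1a `stub_truncLatticeCount` (p139091), T1b `stub_tssCompose stub_tssInduction
stub_tssLocalData` (p151735, p147673, p149169), T0' `stub_moebiusTermBV` (p151428), S1-D `stub_termExpansion`
(p151427), S1-E `stub_termClassSums` (p153308), S2 `stub_assembly` (p138577).

References: D. A. Goldston, C. Y. Yıldırım, Integers 3 (2003) A5, Lemma 2.1 [GoldstonYildirim2001]; B. Green,
T. Tao, Ann. of Math. 171 (2010), Conj. 1.4, App. D [GreenTao2010]; W. Sawin, M. Shusterman, arXiv:1808.04001,
Cor. 6.1 [SawinShusterman2018]; J. Lichtman, J. Teräväinen (2022) Conj. 1.1 [LichtmanTeravainen2022];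
T. Tao, J. Teräväinen (2021) Conj. 1.3 [TaoTeravainen2021].
-/

noncomputable section

open scoped BigOperators Classical
open Filter Finset Literature.NumberTheory.Sieve
open Summit.Parity.GeneralizedHardyLittlewood.Theses.LeeYangFibres (RelativeDimOne)
open Summit.Parity.GeneralizedHardyLittlewood.Theorems.AbsoluteUpgrade (archFactor_le_two_mul)

namespace Summit.Parity.GeneralizedHardyLittlewood.Cruxes.RelativeDimOne.SingleMoebiusSplit

/-! ## T1: the all-truncated sum carries the main term -/

/-- **T1b** (landed pieces composed): the truncated singular series is asymptotic to `𝔖(Ψ)` uniformly along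
staggered levels. -/
theorem truncSingularSeriesAsymp_succ (k : ℕ) : TruncSingularSeriesAsymp (k + 1) :=
  stub_tssCompose stub_tssInduction stub_tssLocalData k

/-- **T1 = T1a + T1b**: the all-truncated sum carries the whole main term `β_∞𝔖` with Green–Tao's error
`ε(β_∞𝔖 + N)`, from the lattice count (error `εN/2`) and the singular-series asymptotic (error
`(ε/4)(𝔖 + 1)`, multiplied by `β_∞ ≤ 2N`). -/
theorem truncatedMainTerm_of_parts {t : ℕ} (hA : TruncLatticeCount t) (hB : TruncSingularSeriesAsymp t) :
    TruncatedMainTerm t := by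
  intro L δ hδ hstag hsum ε hε
  obtain ⟨N₁, hN₁⟩ := hA L δ hδ hsum (ε / 2) (by positivity)
  obtain ⟨N₂, hN₂⟩ := hB L δ hδ hstag hsum (ε / 4) (by positivity)
  refine ⟨max N₁ N₂, fun N hN Ψ hΨ hsize K hK hKbox => ?_⟩
  have h1 := hN₁ N (le_of_max_le_left hN) Ψ hΨ hsize K hK hKbox
  have h2 := hN₂ N (le_of_max_le_right hN) Ψ hΨ hsize
  set T := truncCorrSum Ψ K N (fun i => (N : ℝ) ^ (δ i))
  set S := truncSingularSeries Ψ (fun i => (N : ℝ) ^ (δ i))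
  have hβ0 : 0 ≤ archFactor Ψ K := ENNReal.toReal_nonneg
  have hβ2 : archFactor Ψ K ≤ 2 * (N : ℝ) := archFactor_le_two_mul Ψ hKbox
  have h𝔖 : 0 ≤ singularProduct Ψ := singularProduct_nonneg' hΨ
  have hsplit : T - archFactor Ψ K * singularProduct Ψ =
      (T - archFactor Ψ K * S) + archFactor Ψ K * (S - singularProduct Ψ) := by ring
  rw [hsplit]
  calc |(T - archFactor Ψ K * S) + archFactor Ψ K * (S - singularProduct Ψ)|
      ≤ |T - archFactor Ψ K * S| + |archFactor Ψ K * (S - singularProduct Ψ)| := abs_add_le _ _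
    _ = |T - archFactor Ψ K * S| + archFactor Ψ K * |S - singularProduct Ψ| := by
        rw [abs_mul, abs_of_nonneg hβ0]
    _ ≤ ε / 2 * N + archFactor Ψ K * (ε / 4 * (singularProduct Ψ + 1)) :=
        add_le_add h1 (mul_le_mul_of_nonneg_left h2 hβ0)
    _ ≤ ε * (archFactor Ψ K * singularProduct Ψ + N) := by
        nlinarith [mul_nonneg hβ0 h𝔖, hε.le, mul_le_mul_of_nonneg_left hβ2 hε.le]

/-- **T1 for `k + 1` forms**, unconditionally. -/
theorem truncatedMainTerm_succ (k : ℕ) : TruncatedMainTerm (k + 1) :=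
  truncatedMainTerm_of_parts (stub_truncLatticeCount k) (truncSingularSeriesAsymp_succ k)

/-! ## S1: term `j ≥ 1` from the atom `H_j` -/

/-- `N^{1/2} ≤ (ε/2) N` for `N ≥ 4/ε²`. -/
theorem rpow_half_le_half_eps_mul {ε : ℝ} (hε : 0 < ε) {N : ℕ} (hN : 4 / ε ^ 2 ≤ (N : ℝ)) :
    (N : ℝ) ^ (1 / 2 : ℝ) ≤ ε / 2 * N := by
  rw [← Real.sqrt_eq_rpow]
  have hε0 : ε ≠ 0 := hε.ne'
  have hsN : Real.sqrt N * Real.sqrt N = N := Real.mul_self_sqrt (Nat.cast_nonneg N)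
  have h2ε : 2 / ε ≤ Real.sqrt N := by
    rw [show (2 / ε : ℝ) = Real.sqrt ((2 / ε) ^ 2) by rw [Real.sqrt_sq (by positivity)]]
    refine Real.sqrt_le_sqrt ?_
    rw [div_pow]
    norm_num
    exact hN
  have h0 : 0 ≤ Real.sqrt N := Real.sqrt_nonneg _
  have hone : (1 : ℝ) ≤ ε / 2 * Real.sqrt N := by
    have h := mul_le_mul_of_nonneg_left h2ε (by positivity : (0 : ℝ) ≤ ε / 2)
    rwa [show ε / 2 * (2 / ε) = (1 : ℝ) by field_simp] at h
  have h1 : Real.sqrt N ≤ ε / 2 * (Real.sqrt N * Real.sqrt N) := by nlinarith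
  rwa [hsN] at h1

/-- **S1 = S1-D + S1-E** (`ε/2 + ε/2`): term `j ≥ 1` of the telescoping is `o(N)` given the atom `H_j` at
Möbius-dilation exponent `η`, along levels staggered by `2 + 1/η`. -/
theorem termBound_of_hybrid : ∀ (k : ℕ) (j : Fin (k + 1)), j ≠ 0 → ∀ η : ℝ, 0 < η →
    (∀ C A : ℝ, HybridOneMoebius (j : ℕ) η C A) → TermBound k j η := by
  intro k j hj η hη hH L δ hδ hstag hsum ε hε
  obtain ⟨N₁, hN₁⟩ := stub_termExpansion k j hj L δ hδ hsum
  obtain ⟨N₂, hN₂⟩ := stub_termClassSums k j hj η hη hH L δ hδ hstag hsum (ε / 2) (by positivity)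
  refine ⟨max (max N₁ N₂) ⌈4 / ε ^ 2⌉₊, fun N hN Ψ hΨ hsize K hK hKbox => ?_⟩
  have h1 := hN₁ N (le_trans (le_max_left _ _) (le_of_max_le_left hN)) Ψ hΨ hsize K hK hKbox
  have h2 := hN₂ N (le_trans (le_max_right _ _) (le_of_max_le_left hN)) Ψ hΨ hsize K hK hKbox
  have h3 : (N : ℝ) ^ (1 / 2 : ℝ) ≤ ε / 2 * N :=
    rpow_half_le_half_eps_mul hε ((Nat.le_ceil _).trans (by exact_mod_cast le_of_max_le_right hN))
  linarith

/-! ## The reduction -/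

/-- **The `(k+1)`-form slice of the crux needs the atom only for `1 ≤ s ≤ k`.** Telescoping + T1 + T0' + S1 for
`1 ≤ j ≤ k` (`stub_assembly`), the term `j` fed with the atom `H_j`. -/
theorem relDimOneSlice_of_hybrid_below (k : ℕ)
    (hH : ∀ s : ℕ, 1 ≤ s → s ≤ k → ∃ η : ℝ, 0 < η ∧ ∀ C A : ℝ, HybridOneMoebius s η C A) :
    RelDimOneSlice (k + 1) := by
  refine stub_assembly k (truncatedMainTerm_succ k) (stub_moebiusTermBV k) fun j hj => ?_
  have hj1 : 1 ≤ (j : ℕ) := Nat.one_le_iff_ne_zero.mpr fun h => hj (Fin.ext h)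
  have hjk : (j : ℕ) ≤ k := Nat.lt_succ_iff.mp j.isLt
  obtain ⟨η, hη, hHj⟩ := hH (j : ℕ) hj1 hjk
  exact ⟨η, hη, termBound_of_hybrid k j hj η hη hHj⟩

/-- **THE REDUCTION — the crux follows from the single-Möbius hybrid atom alone** (registered sub-goal of
stmt-Parity-14113; the atom is an open problem, so this does not close the item). -/
theorem relativeDimOne_of_hybrid :
    (∀ s : ℕ, 1 ≤ s → ∃ η : ℝ, 0 < η ∧ ∀ C A : ℝ, HybridOneMoebius s η C A) →
    Summit.Parity.GeneralizedHardyLittlewood.Theses.LeeYangFibres.RelativeDimOne := by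
  intro hH t L ht ε hε
  obtain ⟨k, rfl⟩ : ∃ k, t = k + 1 := ⟨t - 1, by omega⟩
  exact relDimOneSlice_of_hybrid_below k (fun s hs _ => hH s hs) L ε hε

/-! ## Unconditional and low slices -/

/-- Exponent vectors on `Fin 1` are trivially staggered (there is no later index). -/
theorem staggeredBy_fin_one' (c : ℝ) (δ : Fin 1 → ℝ) (hδ : 0 ≤ δ 0) : StaggeredBy c δ := by
  intro i
  have hi : i = 0 := Subsingleton.elim i 0
  subst hi
  have : Finset.Ioi (0 : Fin 1) = ∅ :=
    Finset.eq_empty_of_forall_notMem fun j hj => by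
      have h := Finset.mem_Ioi.mp hj
      exact absurd (Subsingleton.elim (0 : Fin 1) j ▸ h) (lt_irrefl _)
  rw [this, Finset.sum_empty, mul_zero]
  exact hδ

/-- **The one-form slice of the crux, UNCONDITIONALLY**: for every `L`, `ε > 0` and `N ≥ N₀(L, ε)`, uniformly over
non-degenerate forms `ψ(n) = a n + b` with `|a| + |b|/N ≤ L` and convex `K ⊆ [−N, N]`,
`|∑_{n ∈ K∩ℤ} Λ(ψ(n)) − β_∞ 𝔖(ψ)| ≤ ε (β_∞𝔖(ψ) + N)` — no atom is consumed at `t = 1`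
(`Λ = Λ_{R} + (Λ − Λ_R)` with `R = N^{1/8}`: T1 at `t = 1` and T0' at `k = 0`). -/
theorem relDimOneSlice_one : RelDimOneSlice 1 :=
  relDimOneSlice_of_hybrid_below 0 fun s hs hs0 => absurd (hs.trans hs0) (by norm_num)

/-- **The two-form slice from `H_1` alone**: uniform Hardy–Littlewood asymptotics (relative + absolute error) for
pairs `(ψ₀, ψ₁)` of non-degenerate `d = 1` forms — twin-prime and Goldbach-type counts included — follow from the
single statement "Möbius along a progression of modulus `≤ L Y^η` is orthogonal to ONE dilated shifted prime with a
log-power saving". -/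
theorem relDimOneSlice_two_of_hybrid_one
    (hH1 : ∃ η : ℝ, 0 < η ∧ ∀ C A : ℝ, HybridOneMoebius 1 η C A) : RelDimOneSlice 2 :=
  relDimOneSlice_of_hybrid_below 1 fun s hs hs1 => by
    obtain rfl : s = 1 := le_antisymm hs1 hs
    exact hH1

end Summit.Parity.GeneralizedHardyLittlewood.Cruxes.RelativeDimOne.SingleMoebiusSplit
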